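/-
Copyright: the b2b-balaban T⁴-continuum CRUX team, row NE7b OWNER lineage `t4-ne7b-p1` (gen 134). Project licence.
-/
import Summits.QuantumFields.BalabanUV.T4Continuum.Spine.NE7b.SupClusterSupportRegrouping
import Mathlib.MeasureTheory.Integral.Prod

/-!
# THE KOTECKÝ–PREISS LOGARITHM, THE TRUNCATED WEIGHTS AND THE SUPPORT TERMS ARE MEASURABLE FUNCTIONS OF THE ACTIVITY VECTOR — SCOPING-d6 (L5),
# abstract half: with the PRODUCT σ-algebra on the activity vectors `P → ℂ` (any polymer type `P`), the maps
#   `w ↦ Ξ(Λ; w)`,  `(w, t) ↦ (d∕dt)Ξ(Λ; tw)`,  `w ↦ log Z(Λ; w) = ∫₀¹ Ż∕Z`,  `w ↦ Φ^T(C; w)`,  `w ↦ Σ_{𝒞 ⊆ L, p 𝒞} Φ^T(𝒞; w)`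
# are MEASURABLE (finite sums of products of coordinates; a parametric interval integral of a jointly measurable integrand — Fubini's measurability
# half `StronglyMeasurable.integral_prod_right`, the junk conventions of `∫` and `∕` included), and measurability survives precomposition with any
# family `ψ ↦ w_ψ` whose COORDINATES are measurable (`measurable_pi_iff`, no countability of `P` needed).  So the next potential's support terms
# `ψ ↦ K⁺_Y(ψ)` of (354)∕(355) are measurable in the external field as soon as each activity `ψ ↦ z_ψ(Y')` is — the road half is the
# successor file (row NE7b, node U5c; Mathlib's `measurable_pi_apply`, `Finset.measurable_sum∕prod`, `Measurable.div`,
# `StronglyMeasurable.integral_prod_right`, `intervalIntegral.integral_of_le` BY NAME; [folklore])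

Cell `pub-balaban`, sub-cell `t4`, spine estimate NE7b (`T4WeightBudget.RelWeightBound`; the cell's OWN estimate — NOT PRINTED in
[Bałaban 1983–89], NOT PROVED).  Crux-route work under `Spine/NE7b/` by the row OWNER (`t4-ne7b-p1` gen 134, file (369)) under FREEZE
(0)'s crux-prover clause, on `g134/records/SCOPING-d6-iteration.md` (L5); NOTHING of Bałaban's is named as a Lean object, valued or asserted; no
`T4Continuum/Support` leaf typed; no `def`, no notation; zero `sorry`.  Imports (BY NAME): the OWNER's (354) (for the tree's `polymerPartitionFunction`,
`polymerRayDeriv`, `polymerLogZ`, `truncatedWeight`, `IsCompatible`); `Mathlib.MeasureTheory.Integral.Prod`.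

WHAT IS PROVED ([folklore]; `MeasurableSpace (P → ℂ)` = the product σ-algebra):
* §1 **`measurable_polymerPartitionFunction`**, `measurable_polymerPartitionFunction_scaled` (jointly in `(w, t)`), **`measurable_polymerRayDeriv`**
  (jointly), **`measurable_polymerLogZ`**, **`measurable_truncatedWeight`**, **`measurable_supportSum`** (`w ↦ Σ_{𝒞 ⊆ L, p 𝒞}Φ^T(𝒞; w)`);
* §2 **`measurable_comp_of_coords`** (measurable coordinates `ψ ↦ w_ψ γ` for all `γ` + a measurable functional ⟹ measurable composite),
  `measurable_supportSum_of_coords`; §3 toy.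

HONEST (what this is NOT).  Measurability only (no continuity ∕ analyticity statement, no bound); the road half — each `ψ ↦ z_ψ(Y')` measurable by
Fubini for the Gaussian road, and measurability of `K⁺_Y` in the CELLS of `Y` via (363)'s cut-off — is the successor's; scalar skeleton ((A3), NC-NE7b-α
UNRULED); nothing of Bałaban's asserted.  BY-NAME EFFECT ON THE WALL: NONE.  NE7b NOT PRINTED ∕ NOT PROVED; spine PROVED 0∕9; rung (B)+1 — the
programme's measures remain FINITE-torus statements; NOT the mass gap, NOT Clay.  HONEST DEPENDENCY: continuum YM on T⁴ ⇐ BetaPertH ∧ nine spine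
estimates (0∕9 proved); BetaPertH ⇐ (D1) ∧ (D4) ∧ CAP+tail; G-an2-4 gates asym, D1 and NE2∕3∕4.
-/

set_option autoImplicit false

noncomputable section

namespace Summit.QuantumFields.BalabanUV.T4Continuum.NE7b.SupPolymerLogZMeasurable

open MeasureTheory Finset
open scoped BigOperators
open Literature.Probability.LatticeModels

variable {P : Type*} [DecidableEq P] {inc : P → P → Prop} [DecidableRel inc]

/-! ## §1. Measurability in the activity vector -/

/-- **`w ↦ Ξ(Λ; w)` is measurable** (a finite sum of finite products of coordinates). [folklore] -/
theorem measurable_polymerPartitionFunction (Λ : Finset P) :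
    Measurable fun w : P → ℂ => polymerPartitionFunction inc w Λ := by
  unfold polymerPartitionFunction
  refine Finset.measurable_sum _ fun A _ => ?_
  by_cases hA : IsCompatible inc A
  · simp only [hA, if_true]
    exact Finset.measurable_prod _ fun γ _ => measurable_pi_apply γ
  · simp only [hA, if_false]
    exact measurable_const

/-- **`(w, t) ↦ Ξ(Λ; t·w)` is jointly measurable.** [folklore] -/
theorem measurable_polymerPartitionFunction_scaled (Λ : Finset P) :
    Measurable fun q : (P → ℂ) × ℝ => polymerPartitionFunction inc (fun γ => (q.2 : ℂ) * q.1 γ) Λ := by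
  unfold polymerPartitionFunction
  refine Finset.measurable_sum _ fun A _ => ?_
  by_cases hA : IsCompatible inc A
  · simp only [hA, if_true]
    exact Finset.measurable_prod _ fun γ _ =>
      (Complex.measurable_ofReal.comp measurable_snd).mul ((measurable_pi_apply γ).comp measurable_fst)
  · simp only [hA, if_false]
    exact measurable_const

/-- **`(w, t) ↦ (d∕dt)Ξ(Λ; t·w)` is jointly measurable.** [folklore] -/
theorem measurable_polymerRayDeriv (Λ : Finset P) :
    Measurable fun q : (P → ℂ) × ℝ => polymerRayDeriv inc q.1 Λ q.2 := by
  unfold polymerRayDeriv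
  refine Finset.measurable_sum _ fun X _ => ?_
  exact (measurable_const.mul ((Complex.measurable_ofReal.comp measurable_snd).pow_const _)).mul
    (Finset.measurable_prod _ fun γ _ => (measurable_pi_apply γ).comp measurable_fst)

/-- **THE KOTECKÝ–PREISS LOGARITHM IS MEASURABLE IN THE ACTIVITY VECTOR**: `w ↦ log Z(Λ; w) = ∫₀¹ Ż_t∕Z_t dt` is measurable (parametric integral
of a jointly measurable integrand; Lean's junk values of `∕` and `∫` included). [folklore] -/
theorem measurable_polymerLogZ (Λ : Finset P) : Measurable fun w : P → ℂ => polymerLogZ inc w Λ := by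
  have hF : Measurable fun q : (P → ℂ) × ℝ =>
      polymerRayDeriv inc q.1 Λ q.2 / polymerPartitionFunction inc (fun γ => (q.2 : ℂ) * q.1 γ) Λ :=
    (measurable_polymerRayDeriv Λ).div (measurable_polymerPartitionFunction_scaled Λ)
  have hSM : StronglyMeasurable (Function.uncurry fun (w : P → ℂ) (t : ℝ) =>
      polymerRayDeriv inc w Λ t / polymerPartitionFunction inc (fun γ => (t : ℂ) * w γ) Λ) := hF.stronglyMeasurable
  have h := (hSM.integral_prod_right (ν := volume.restrict (Set.Ioc (0 : ℝ) 1))).measurable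
  unfold polymerLogZ
  simp_rw [intervalIntegral.integral_of_le zero_le_one]
  exact h

/-- **The truncated weights are measurable in the activity vector.** [folklore] -/
theorem measurable_truncatedWeight (C : Finset P) : Measurable fun w : P → ℂ => truncatedWeight inc w C := by
  unfold truncatedWeight
  exact Finset.measurable_sum _ fun B _ => (measurable_polymerLogZ B).const_mul _

/-- **The support terms are measurable in the activity vector**: for every family `L` and decidable predicate `p` on clusters,
`w ↦ Σ_{𝒞 ⊆ L, p 𝒞} Φ^T(𝒞; w)` is measurable. [folklore] -/
theorem measurable_supportSum (L : Finset P) (p : Finset P → Prop) [DecidablePred p] :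
    Measurable fun w : P → ℂ => ∑ 𝒞 ∈ L.powerset with p 𝒞, truncatedWeight inc w 𝒞 :=
  Finset.measurable_sum _ fun 𝒞 _ => measurable_truncatedWeight 𝒞

/-! ## §2. Precomposition with a measurable family of activities -/

omit [DecidableEq P] [DecidableRel inc] in
/-- **MEASURABLE COORDINATES SUFFICE**: if every coordinate `ψ ↦ w_ψ γ` is measurable and `F` is measurable on the activity vectors (product
σ-algebra, ANY index type), then `ψ ↦ F(w_ψ)` is measurable. [folklore] -/
theorem measurable_comp_of_coords {Ω : Type*} [MeasurableSpace Ω] {w : Ω → P → ℂ} (hw : ∀ γ, Measurable fun ψ => w ψ γ)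
    {F : (P → ℂ) → ℂ} (hF : Measurable F) : Measurable fun ψ => F (w ψ) :=
  hF.comp (measurable_pi_iff.2 hw)

/-- **THE SUPPORT TERMS OF A MEASURABLE FAMILY OF ACTIVITIES ARE MEASURABLE**: `ψ ↦ Σ_{𝒞 ⊆ L, p 𝒞}Φ^T(𝒞; w_ψ)` is measurable when every
`ψ ↦ w_ψ γ` is. [folklore] -/
theorem measurable_supportSum_of_coords {Ω : Type*} [MeasurableSpace Ω] {w : Ω → P → ℂ} (hw : ∀ γ, Measurable fun ψ => w ψ γ)
    (L : Finset P) (p : Finset P → Prop) [DecidablePred p] :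
    Measurable fun ψ => ∑ 𝒞 ∈ L.powerset with p 𝒞, truncatedWeight inc (w ψ) 𝒞 :=
  measurable_comp_of_coords hw (measurable_supportSum L p)

/-! ## §3. Toy -/

/-- Toy (§1): on the EMPTY family the partition function is the measurable constant `w ↦ Ξ(∅; w)`. -/
example : Measurable fun w : P → ℂ => polymerPartitionFunction inc w ∅ := measurable_polymerPartitionFunction ∅

end Summit.QuantumFields.BalabanUV.T4Continuum.NE7b.SupPolymerLogZMeasurable
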